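import Summits.QuantumFields.YangMills.Theorems.BalabanUVNodesN11TStepInnerCentralWindowChartAtRegionsOfProvisos
import Summits.QuantumFields.YangMills.Theorems.BalabanUVNodesN11StepWeightSupportOfRecord
import Summits.QuantumFields.YangMills.Theorems.BalabanUVNodesN11ApproxFluctPlaquetteComparison

/-!
# DAG node N11 — THE SUPPORT CLAUSE OF THE CENTRAL-WINDOW ROAD REDUCED TO BACKGROUND REGULARITY: FILE 13's kernel-level LEFT side of (O3′) at def-R's regions
# from the core provisos, with `hwS` PRODUCED from def-T's own step weights (dag-n11-w2's `support_of_wOfRecord_ne_zero`) — displayed instead: ONE lattice-gauge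
# bridge (§2), or (§3) a BACKGROUND row ((3.2) ⇒ small level-`k` plaquettes of `V^{(k)}_{□′} = M^k(U_{k+1,□′}(V′))`) + a COVERING row + numerics, the (3.3) algebra discharged

HEADER — WORK-UNIT METADATA.  Cell `pub-ymgap`, YM-PLAN Track A (HUMAN RULING D-0062), seat `pub-ymgap-dag-n08-w2` (g10; WIDTH SEAT 2∕4 on N08 [B10], RE-POINTED to
N11's [III] §3-supply residue), route `BalabanUVNodes`, key item K1⁷ `StabilityBAtRecordR13SepCoPH` = stmt-QuantumFields-20542 (helper lane, `--kind proof --supports 20542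
--as helper` — jail key; K1⁹ stmt-QuantumFields-27364 is the K1-face of record, mis-key rule; count-neutral; (B4)-socket bookkeeping).  [III] = [Balaban1988Convergent],
[I] = [Balaban1987RG1].  FILE 14 of this seat's kernel-level socket = FILE 13 `…N11TStepInnerCentralWindowChartAtRegionsOfProvisos` (p636743: ★★★
`exists_ae_forall_slotsTOfRecord₁₃H_succ_eq_kernelRTOfRecord_atRegions_of_provisos`, ★ `…_of_plaqSmall`) composed BY NAME with dag-n11-w2 g4's FILE 10
`…N11StepWeightSupportOfRecord` (★★ `support_of_wOfRecord_ne_zero`: wherever def-T's step weight of record `w_k(s)(U, V′) ≠ 0` — 𝐃-cubes of positive side — at EVERY χ-cube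
`□′ ⊆ Ω_{k+1}(s)` the coarse one-cube background `U_{k+1,□′}(V′)` has (3.2)-small plaquettes on `{p ⊂ □′^∼}` AND the level-`k` field `U` is (3.3)-close to
`V^{(k)}_{□′}(V′) = M^k(U_{k+1,□′}(V′))` on `(□′^{∼2})^{(k)*}`), r11's `B14.Sect3Decomp` (`Sect3Data`, `Vbox`, `SmallApproxFluct`) and the tree's
`BlockAveragingTowerStraightTransportLocal.dist1_mul_mul_inv_mul_le` (the two-factor `dist1` telescoping from bi-invariance) and `B11GaugeGlue.dist1_inv_mul_eq`.  CONSUMED BY NAME,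
nothing modified.

WHY THIS FILE.  FILE 13 displays, beside the three numeric α-guards and ONE measurability row (`hslot`), the SUPPORT CLAUSE `hwS` «`w_k(s)(U, V′) ≠ 0 ⇒ ∀ c ∉ bondsIn (k+1)
(Ω_{k+1}(s))ᶜ, ∀ i, dist1 (loopHol U c i) ≤ α`» (resp. `hwq`, plaquette currency) — a property of def-T's PRIVATE weight function.  dag-n11-w2's FILE 10 unpacks that weight:
`w ≠ 0` exhibits a label whose (3.2)∕(3.3) characteristic functions are `1` at every χ-cube inside `Ω_{k+1}(s)`.  So the support clause is NOT a property of the weights any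
more but ONE lattice-gauge statement: «(3.2) on the one-cube backgrounds + (3.3) closeness at the χ-cubes of `Ω_{k+1}(s)` ⇒ the (0.4) loop variables of `U` at the coarse bonds
meeting `Ω_{k+1}(s)` are `≤ α`» (§2's `hbridge`, the central-window twin of the `hbridge` of dag-n11-w2's `…PrivateInnerChartOfSupport` on the private-inner-chart road).  §3 splits
that bridge into its three constituents and DISCHARGES the elementary one: by the four-bond telescoping of §1, (3.3) puts every level-`k` plaquette of `U` whose bonds lie in
`(□′^{∼2})^{(k)*}` within `4·2δ_k` of the corresponding plaquette of the BACKGROUND `V^{(k)}_{□′}(V′)`; what remains displayed is (a) the BACKGROUND row `hbg` «(3.2) on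
`U_{k+1,□′}(V′)` ⇒ the level-`k` plaquettes of `M^k(U_{k+1,□′}(V′))` on `(□′^{∼2})^{(k)*}` are within `a` of `1`» — regularity of the (2.16) minimiser under the `k`-fold
average ([15] = Balaban1985Variational ∕ N07 content: the SHARP block-averaging tower bound; the tree's crude local Prop. 1 `BlockAveragingPlaquetteBoundLocal.plaqSmallOn_avgFun_of_near`
has constant `L² + 6((d+2)L)²` per level, i.e. `(1 + 6(d+2)²)^k` against `η² = L^{−2(k+1)}` — NOT uniform in `k`, so it does NOT discharge `hbg`), (b) the COVERING row `hcov`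
«every level-`k` plaquette based in the three blocks around a coarse bond meeting `Ω_{k+1}(s)` has its four bonds in `(□′^{∼2})^{(k)*}` for SOME χ-cube `□′ ⊆ Ω_{k+1}(s)`» — pure
lattice geometry; it holds when `Ω_{k+1}(s)` is a union of χ-cubes (print's (3.5): *«we surround … by two layers of such cubes»*), which in def-T's typing (hulls and fills by
𝐃_{k+1}-cubes of side `L^{k+1}MR_{k+1}`, χ-cubes of side `L^{k+2}M₂R_{k+1}`) is the nesting numerics `M₂∕M` of node00-def's admissibility — DISPLAYED, and (c) the numerics
`a + 4·2δ_k ≤ δ`, `((d+2)L)²∕4·δ ≤ α`.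

WHAT THIS FILE PROVES (0 `def`, 0 `sorry`, standard axioms).
§1 (any `GaugeGroup`, two fields, one plaquette) ★ `dist1_plaqHol_mul_inv_plaqHol_le` (`dist1 (U(∂q)·V(∂q)⁻¹) ≤ Σ_{b ∈ ∂q} dist1 (U_b·V_b⁻¹)`) ·
`dist1_plaqHol_le_add_of_bonds` · (r11 `Sect3Data`-generic) ★ `dist1_plaqHol_lt_of_smallApproxFluct` (`SmallApproxFluct D av 2δ V_k V □′`, the four bonds of `q` in `D.bondsStar □′`,
`dist1 (V^{(k)}_{□′}(∂q)) ≤ a` ⇒ `dist1 (V_k(∂q)) < a + 4·2δ`).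
§2 ★★★ `exists_ae_forall_slotsTOfRecord₁₃H_succ_eq_kernelRTOfRecord_atRegions_of_provisos_of_support` (FILE 13 ★★★ with `hwS` ↦ `hD : 0 < sideD` + `hbridge`).
§3 ★★★ `exists_ae_forall_slotsTOfRecord₁₃H_succ_eq_kernelRTOfRecord_atRegions_of_provisos_of_background` (FILE 13 ★ `_of_plaqSmall` with `hwq` ↦ `hD` + `hbg` + `hcov` + numerics).
§4 ★★ `exists_ae_forall_tstepOfRecord_eq_kernelRTOfRecord_atRegions_of_background` (FILE 12's (†) ∀ `s′` in plaquette currency, generic letters `ν M A₁ ζ`, AT def-T's weights of record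
`w := wOfRecord … A₁ ζ`: `hwq` ↦ `hD` + `hbg` + `hcov` + numerics — the edition dag-n11-d's per-density road consumes).

HONEST FRAMING.  Helper lane of K1⁷ (aside key); count-neutral; by-name composition (FILE 13 ∕ FILE 12 + dag-n11-w2's FILE 10) + one four-term `dist1` telescoping; the BACKGROUND
row `hbg` (regularity of the (2.16) minimiser under `M^k` — [15]∕N07 content, NOT derived), the COVERING row `hcov` (node00-def nesting numerics, NOT derived), resp. the whole
bridge `hbridge` (§2), the row `hslot` and `θ.Provisos₁₃CoPH` REMAIN HYPOTHESES, displayed; NO chart of Bałaban's ((47), [III] (3.10)–(3.25)) asserted; nothing of Bałaban ([I] §2,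
[III] §3, Thm 1–2) asserted; (B4)∕(S-α)∕(O3′) NOT closed; N11 NOT discharged; N08 untouched; K1⁷∕K1⁸∕K1⁹ NOT closed, no registered stub touched; counts unmoved (typed 28∕28 ·
discharged 5∕27 · A 5∕28).  One finite `𝕋⁴_{L^K}` programme at fixed `ε = L^{−K}`; R4 closes only the conditional finite-𝕋⁴ rung `BalabanLadder.UV` — NOT ℝ⁴, NOT OS, NOT a mass
gap, NOT Clay.  No `sorry`, `axiom`, `def`, `instance`, `notation`.
Sources (SHAPE ∕ bookkeeping only): [III] (2.16)–(2.18) p.257, (2.21) p.258, (3.1) p.264, (3.2)–(3.5) p.265, (3.16) p.268, p.267 L18–24, (3.24)–(3.25) p.270; [I] (0.4) p.253;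
[Balaban1985Averaging] (9) p.19, (19)–(20) p.21.
-/

noncomputable section

open MeasureTheory ProbabilityTheory Set Function
open scoped ENNReal NNReal

namespace Summit.QuantumFields.YangMills.Theorems.BalabanUVNodesN11TStepInnerCentralWindowChartAtRegionsOfSupport

open Literature.MathematicalPhysics.QuantumFieldTheory.Balaban1983to89
open Literature.MathematicalPhysics.QuantumFieldTheory.Balaban1983to89.T4AveragingDisintegration
open Literature.MathematicalPhysics.QuantumFieldTheory.Balaban1983to89.BlockAveraging (Small Idx avgFun loopHol)
open Literature.MathematicalPhysics.QuantumFieldTheory.Balaban1983to89.BlockAveragingHaarAC (centralBond pre post centralBond_injective isLocal_avgFun)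
open Literature.MathematicalPhysics.QuantumFieldTheory.Balaban1983to89.BlockAveragingEMLHaarAC (fibreFamily offCard)
open Literature.MathematicalPhysics.QuantumFieldTheory.Balaban1983to89.ExpMeanLog (expMeanLogSU deltaSU)
open Literature.MathematicalPhysics.QuantumFieldTheory.Balaban1983to89.B14.Sect3Decomp (Sect3Data Vbox SmallApproxFluct)
open Literature.MathematicalPhysics.QuantumFieldTheory.Balaban1983to89.B14.Eq218Concrete (cubesIn mem_cubesIn)
open BalabanUVNodesN11TStepInnerCentralWindowChartAtRegions BalabanUVNodesN11TStepInnerCentralWindowChartAtRegionsOfProvisos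
open BalabanUVNodesN11PrivateChartOfCentralWindow (loops_small_of_plaqSmallOn_blocks)
open BalabanUVNodesN11TransportOfRecordInPrivateCoordinateChart (succ_le_m_add_K)
open BalabanUVNodesN11ApproxFluctPlaquetteComparison (dist1_plaqHol_lt_of_smallApproxFluct bonds_mem_bondsStar_of_embIter_mem_cubeχ)
open BalabanUVNodesN11StepWeightSupportOfRecord (support_of_wOfRecord_ne_zero exists_label_of_wOfRecord_ne_zero plaqSmallOn_ukLoc_of_aWeight_ne_zero
  smallApproxFluct_of_bWeight_ne_zero)
open Literature.MathematicalPhysics.QuantumFieldTheory.Balaban1983to89.B15DeterminingSets (embIter)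

open Node00 hiding SU
open T4Continuum
open B10Eq42TorusConstraint (bondsIn)
open B10Eq38TorusDomains (toFine)


variable {F : T4Family} {N : ℕ} [NeZero N] (p : B12.RunParams) {k : ℕ}

/-! ## §2  FILE 13's ★★★ with the support clause PRODUCED from def-T's step weights: displayed instead, ONE lattice-gauge bridge -/

/-- **★★★ THE KERNEL-LEVEL LEFT SIDE OF (O3′) AT def-R's REGIONS FROM THE CORE PROVISOS, THE SUPPORT CLAUSE READ OFF def-T's OWN STEP WEIGHTS**: FILE 13 ★★★
`exists_ae_forall_slotsTOfRecord₁₃H_succ_eq_kernelRTOfRecord_atRegions_of_provisos` with its hypothesis `hwS` («`w_k(s)(U,V′) ≠ 0 ⇒` the (0.4) loops of `U` at the coarse bonds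
meeting `Ω_{k+1}(s)` are `≤ α`») REPLACED by `hD : 0 < sideD` (genuine 𝐃_{k+1}-cubes) and ONE lattice-gauge bridge `hbridge` «(3.2) on the one-cube backgrounds `U_{k+1,□′}(V′)` and
(3.3) closeness of `U` to `V^{(k)}_{□′}(V′)` at EVERY χ-cube `□′ ⊆ Ω_{k+1}(s)` ⇒ the (0.4) loops of `U` at the coarse bonds meeting `Ω_{k+1}(s)` are `≤ α`» — `hwS` is PRODUCED inside
from dag-n11-w2's ★★ `support_of_wOfRecord_ne_zero` (def-T's `w_k(s) = Σ_t a(P)·b(P,Q)·ζ(R,S)` unpacked).  Conclusion verbatim FILE 13's: jointly measurable `(T, ϑ, jd)` with, for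
`dV′`-a.e. `V′` and EVERY `s`, `slotsT_{k+1}(s)(V′) = kernelRTOfRecord … [∫ inner central-window chart integral] …`.
[cite: Balaban1988Convergent, (2.18) p.257, (2.21) p.258, (3.1) p.264, (3.2)–(3.5) p.265, (3.16) p.268, p.267 L18–24, (3.24)–(3.25) p.270; Balaban1987RG1, (0.4) p.253] -/
theorem exists_ae_forall_slotsTOfRecord₁₃H_succ_eq_kernelRTOfRecord_atRegions_of_provisos_of_support (θ : Stage13HParams F N) (h : θ.Provisos₁₃CoPH F N)
    (hk : k < p.K) {α : ℝ} (hα0 : 0 ≤ α) (hα : α ≤ 1 / 24) (hαδ : α < deltaSU (Fin N))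
    (hgap : ∀ c : PBond (F.P p.K) (k + 1), (offCard c : ℝ) / (Fintype.card (Idx (F.P p.K)) : ℝ) + 150 * α < 1)
    (hslot : ∀ s₀ : SeqOfRecord F θ.ν θ.τ9.M (gOfRecord₁₃ F N θ.toStage13Params p) p.K k,
      Measurable (slotsOfRecord F N θ.ν θ.τ9 (EOfRecord₁₃ F N θ.toStage13Params) (wOfRecord₉ F N θ.toStage9Params) θ.ppSel p (gOfRecord₁₃ F N θ.toStage13Params p) k s₀))
    (hD : 0 < sideD F θ.ν θ.τ9.M p (gOfRecord₁₃ F N θ.toStage13Params p) k)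
    (hbridge : ∀ (s : SeqOfRecord F θ.ν θ.τ9.M (gOfRecord₁₃ F N θ.toStage13Params p) p.K (k + 1)) (U : GaugeField (F.P p.K) k (SU N))
      (V' : GaugeField (F.P p.K) (k + 1) (SU N)),
      (∀ c ∈ cubesIn (cubeχ F θ.ν p (gOfRecord₁₃ F N θ.toStage13Params p) k) (s.Ω (k + 1)),
          PlaqSmallOn ((sect3DataOfRecord F N θ.ν θ.τ9.M p (gOfRecord₁₃ F N θ.toStage13Params p) k s.init).plaqT c)
              (epsOfRecord θ.ν (gOfRecord₁₃ F N θ.toStage13Params p) (k + 1) * (F.P p.K).eta (k + 1) ^ 2)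
              ((sect3DataOfRecord F N θ.ν θ.τ9.M p (gOfRecord₁₃ F N θ.toStage13Params p) k s.init).UkLoc c V') ∧
            SmallApproxFluct (sect3DataOfRecord F N θ.ν θ.τ9.M p (gOfRecord₁₃ F N θ.toStage13Params p) k s.init) (avOfRecord F N p.K)
              (2 * deltaOfRecord θ.ν (gOfRecord₁₃ F N θ.toStage13Params p) k θ.A₁) U V' c) →
        ∀ c : PBond (F.P p.K) (k + 1), c ∉ bondsIn (k + 1) (s.Ω (k + 1))ᶜ → ∀ i : Idx (F.P p.K), dist1 (loopHol U c i) ≤ α) :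
    ∃ (T : PBond (F.P p.K) (k + 1) → GaugeField (F.P p.K) k (SU N) → Set (SU N))
      (ϑ : PBond (F.P p.K) (k + 1) → GaugeField (F.P p.K) k (SU N) → SU N → SU N)
      (jd : PBond (F.P p.K) (k + 1) → GaugeField (F.P p.K) k (SU N) → SU N → ℝ≥0),
      (∀ c, MeasurableSet {q : GaugeField (F.P p.K) k (SU N) × SU N | q.2 ∈ T c q.1}) ∧
      (∀ c, Measurable fun q : GaugeField (F.P p.K) k (SU N) × SU N => ϑ c q.1 q.2) ∧
      (∀ c, Measurable fun q : GaugeField (F.P p.K) k (SU N) × SU N => jd c q.1 q.2) ∧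
      ∀ᵐ V' ∂(fieldMeasure (F.P p.K) (k + 1) (SU N)), ∀ s : SeqOfRecord F θ.ν θ.τ9.M (gOfRecord₁₃ F N θ.toStage13Params p) p.K (k + 1),
        slotsTOfRecord F N θ.ν θ.τ9 (EOfRecord₁₃ F N θ.toStage13Params) (wOfRecord₉ F N θ.toStage9Params) θ.ppSel p (gOfRecord₁₃ F N θ.toStage13Params p) (k + 1) s V' =
          kernelRTOfRecord F N p.K k (Set.toFinite (bondsIn k (s.Ω (k + 1))ᶜ)).toFinset (Set.toFinite (bondsIn (k + 1) (s.Ω (k + 1))ᶜ)).toFinset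
            (fun y => ∫ uin,
              (({z : ((↥(Set.toFinite (bondsIn k (s.Ω (k + 1))ᶜ)).toFinset → SU N) ×
                    ({c : PBond (F.P p.K) (k + 1) // c ∉ (Set.toFinite (bondsIn (k + 1) (s.Ω (k + 1))ᶜ)).toFinset} → SU N)) ×
                    ({b : PBond (F.P p.K) k // b ∉ (Set.toFinite (bondsIn k (s.Ω (k + 1))ᶜ)).toFinset} → SU N) |
                  ∀ c : {c : PBond (F.P p.K) (k + 1) // c ∉ (Set.toFinite (bondsIn (k + 1) (s.Ω (k + 1))ᶜ)).toFinset},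
                    z.1.2 c ∈ T c ((MeasurableEquiv.piEquivPiSubtypeProd (fun _ : PBond (F.P p.K) k => SU N)
                      (· ∈ (Set.toFinite (bondsIn k (s.Ω (k + 1))ᶜ)).toFinset)).symm (z.1.1, z.2))}.indicator
                (fun z => ∏ c : {c : PBond (F.P p.K) (k + 1) // c ∉ (Set.toFinite (bondsIn (k + 1) (s.Ω (k + 1))ᶜ)).toFinset},
                  jd c ((MeasurableEquiv.piEquivPiSubtypeProd (fun _ : PBond (F.P p.K) k => SU N)
                    (· ∈ (Set.toFinite (bondsIn k (s.Ω (k + 1))ᶜ)).toFinset)).symm (z.1.1, z.2)) (z.1.2 c))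
                ((y, (MeasurableEquiv.piEquivPiSubtypeProd (fun _ : PBond (F.P p.K) (k + 1) => SU N)
                  (· ∈ (Set.toFinite (bondsIn (k + 1) (s.Ω (k + 1))ᶜ)).toFinset) V').2), uin) : ℝ≥0) : ℝ) *
              ((fun U : GaugeField (F.P p.K) k (SU N) =>
                  wOfRecord₉ F N θ.toStage9Params p (gOfRecord₁₃ F N θ.toStage13Params p) k s U V' *
                    (chiSeqOfRecord F N θ.ν θ.τ9.M (gOfRecord₁₃ F N θ.toStage13Params p) p.K k s.init U *
                      slotsOfRecord F N θ.ν θ.τ9 (EOfRecord₁₃ F N θ.toStage13Params) (wOfRecord₉ F N θ.toStage9Params) θ.ppSel p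
                        (gOfRecord₁₃ F N θ.toStage13Params p) k s.init U))
                ((MeasurableEquiv.piEquivPiSubtypeProd (fun _ : PBond (F.P p.K) k => SU N)
                  (· ∈ (Set.toFinite (bondsIn k (s.Ω (k + 1))ᶜ)).toFinset)).symm (y,
                  extend (fun c : {c : PBond (F.P p.K) (k + 1) // c ∉ (Set.toFinite (bondsIn (k + 1) (s.Ω (k + 1))ᶜ)).toFinset} =>
                      (⟨centralBond (c : PBond (F.P p.K) (k + 1)), centralBond_not_mem_bondsInFinset_compl_Omega hk s c c.2⟩ :
                        {b : PBond (F.P p.K) k // b ∉ (Set.toFinite (bondsIn k (s.Ω (k + 1))ᶜ)).toFinset}))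
                    (fun c : {c : PBond (F.P p.K) (k + 1) // c ∉ (Set.toFinite (bondsIn (k + 1) (s.Ω (k + 1))ᶜ)).toFinset} =>
                      ϑ c ((MeasurableEquiv.piEquivPiSubtypeProd (fun _ : PBond (F.P p.K) k => SU N)
                        (· ∈ (Set.toFinite (bondsIn k (s.Ω (k + 1))ᶜ)).toFinset)).symm (y, uin))
                        ((MeasurableEquiv.piEquivPiSubtypeProd (fun _ : PBond (F.P p.K) (k + 1) => SU N)
                          (· ∈ (Set.toFinite (bondsIn (k + 1) (s.Ω (k + 1))ᶜ)).toFinset) V').2 c)) uin)))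
              ∂(Measure.pi fun _ : {b : PBond (F.P p.K) k // b ∉ (Set.toFinite (bondsIn k (s.Ω (k + 1))ᶜ)).toFinset} => (HaarData.haar : Measure (SU N))))
            (MeasurableEquiv.piEquivPiSubtypeProd (fun _ : PBond (F.P p.K) (k + 1) => SU N)
              (· ∈ (Set.toFinite (bondsIn (k + 1) (s.Ω (k + 1))ᶜ)).toFinset) V').1 := by
  refine exists_ae_forall_slotsTOfRecord₁₃H_succ_eq_kernelRTOfRecord_atRegions_of_provisos p θ h hk hα0 hα hαδ hgap hslot fun s U V' hne => ?_
  obtain ⟨t, -, hsup⟩ := support_of_wOfRecord_ne_zero θ.ν θ.τ9.M θ.A₁ θ.ζ p (gOfRecord₁₃ F N θ.toStage13Params p) k hD s U V' hne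
  exact hbridge s U V' hsup

/-! ## §3  The bridge split: (3.3) algebra DISCHARGED (§1); displayed: the BACKGROUND row, the COVERING row, numerics -/

/-- **★★★ THE KERNEL-LEVEL LEFT SIDE OF (O3′) AT def-R's REGIONS FROM THE CORE PROVISOS, THE SUPPORT CLAUSE REDUCED TO BACKGROUND REGULARITY**: FILE 13 ★ `…_of_plaqSmall` with its
hypothesis `hwq` («`w_k(s)(U,V′) ≠ 0 ⇒` every level-`k` plaquette based in the three blocks around a coarse bond meeting `Ω_{k+1}(s)` is within `δ` of `1`») REPLACED by `hD : 0 < sideD`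
and THREE displayed rows: the BACKGROUND row `hbg` «(3.2) `PlaqSmallOn {p ⊂ □′^∼} (ε_{k+1}η²) (U_{k+1,□′}(V′))` at a χ-cube `□′ ⊆ Ω_{k+1}(s)` ⇒ every level-`k` plaquette with its four
bonds in `(□′^{∼2})^{(k)*}` has `dist1 (V^{(k)}_{□′}(V′)(∂q)) ≤ a`» (regularity of the (2.16) minimiser under `M^k` — [15]∕N07 content, NOT derived), the COVERING row `hcov` «a level-`k`
plaquette based in the three blocks `B(c₋ − e_μ) ∪ B(c₋) ∪ B(c₊)` of a coarse bond `c` meeting `Ω_{k+1}(s)` has its four bonds in `(□′^{∼2})^{(k)*}` for SOME χ-cube `□′ ⊆ Ω_{k+1}(s)`»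
(lattice geometry — node00-def's nesting numerics, NOT derived), and the numerics `0 ≤ δ`, `a + 4·2δ_k ≤ δ`, `((d+2)L)²∕4·δ ≤ α`.  The (3.3) step «`U` is `2δ_k`-close to
`V^{(k)}_{□′}(V′)` bond by bond ⇒ plaquette by plaquette within `4·2δ_k`» is §1 ★; `w ≠ 0 ⇒ (3.2) ∧ (3.3)` at the χ-cubes of `Ω_{k+1}(s)` is dag-n11-w2's ★★.
[cite: Balaban1988Convergent, (2.16)–(2.18) p.257, (2.21) p.258, (3.1) p.264, (3.2)–(3.5) p.265, p.267 L18–24, (3.24)–(3.25) p.270; Balaban1987RG1, (0.4) p.253, (2.9) p.266] -/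
theorem exists_ae_forall_slotsTOfRecord₁₃H_succ_eq_kernelRTOfRecord_atRegions_of_provisos_of_background (θ : Stage13HParams F N) (h : θ.Provisos₁₃CoPH F N)
    (hk : k < p.K) {α : ℝ} (hα0 : 0 ≤ α) (hα : α ≤ 1 / 24) (hαδ : α < deltaSU (Fin N))
    (hgap : ∀ c : PBond (F.P p.K) (k + 1), (offCard c : ℝ) / (Fintype.card (Idx (F.P p.K)) : ℝ) + 150 * α < 1)
    {δ a : ℝ} (hδ : 0 ≤ δ) (hδa : a + 4 * (2 * deltaOfRecord θ.ν (gOfRecord₁₃ F N θ.toStage13Params p) k θ.A₁) ≤ δ)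
    (hδα : ((((F.P p.K).d + 2) * (F.P p.K).L : ℕ) : ℝ) ^ 2 / 4 * δ ≤ α)
    (hslot : ∀ s₀ : SeqOfRecord F θ.ν θ.τ9.M (gOfRecord₁₃ F N θ.toStage13Params p) p.K k,
      Measurable (slotsOfRecord F N θ.ν θ.τ9 (EOfRecord₁₃ F N θ.toStage13Params) (wOfRecord₉ F N θ.toStage9Params) θ.ppSel p (gOfRecord₁₃ F N θ.toStage13Params p) k s₀))
    (hS : 0 < sideχ F θ.ν p (gOfRecord₁₃ F N θ.toStage13Params p) k)
    (hbg : ∀ (s : SeqOfRecord F θ.ν θ.τ9.M (gOfRecord₁₃ F N θ.toStage13Params p) p.K (k + 1)) (V' : GaugeField (F.P p.K) (k + 1) (SU N)) (c' : Iχ F θ.ν p (gOfRecord₁₃ F N θ.toStage13Params p) k),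
      PlaqSmallOn ((sect3DataOfRecord F N θ.ν θ.τ9.M p (gOfRecord₁₃ F N θ.toStage13Params p) k s.init).plaqT c') (epsOfRecord θ.ν (gOfRecord₁₃ F N θ.toStage13Params p) (k + 1) * (F.P p.K).eta (k + 1) ^ 2) ((sect3DataOfRecord F N θ.ν θ.τ9.M p (gOfRecord₁₃ F N θ.toStage13Params p) k s.init).UkLoc c' V') →
        ∀ q : Plaq (F.P p.K) k, embIter k q.src ∈ cubeχ F θ.ν p (gOfRecord₁₃ F N θ.toStage13Params p) k c' →
          dist1 (GaugeField.plaqHol (Vbox (sect3DataOfRecord F N θ.ν θ.τ9.M p (gOfRecord₁₃ F N θ.toStage13Params p) k s.init) (avOfRecord F N p.K) c' V') q) ≤ a)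
    (hcov : ∀ (s : SeqOfRecord F θ.ν θ.τ9.M (gOfRecord₁₃ F N θ.toStage13Params p) p.K (k + 1)) (t : LbOfRecord F θ.ν p (gOfRecord₁₃ F N θ.toStage13Params p) k), σOfRecord F θ.ν θ.τ9.M p (gOfRecord₁₃ F N θ.toStage13Params p) k s.init t = s →
      ∀ c : PBond (F.P p.K) (k + 1), c ∉ bondsIn (k + 1) (s.Ω (k + 1))ᶜ → ∀ q : Plaq (F.P p.K) k,
        (blockOf q.src = c.src.unshift c.dir ∨ blockOf q.src = c.src ∨ blockOf q.src = c.tgt) →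
          ∃ c' : Iχ F θ.ν p (gOfRecord₁₃ F N θ.toStage13Params p) k, embIter k q.src ∈ cubeχ F θ.ν p (gOfRecord₁₃ F N θ.toStage13Params p) k c' ∧
            c' ∈ cubes32 F θ.ν θ.τ9.M p (gOfRecord₁₃ F N θ.toStage13Params p) k s.init \ t.1 ∧ c' ∈ qcubes F θ.ν θ.τ9.M p (gOfRecord₁₃ F N θ.toStage13Params p) k s.init t.1 \ t.2.1) :
    ∃ (T : PBond (F.P p.K) (k + 1) → GaugeField (F.P p.K) k (SU N) → Set (SU N))
      (ϑ : PBond (F.P p.K) (k + 1) → GaugeField (F.P p.K) k (SU N) → SU N → SU N)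
      (jd : PBond (F.P p.K) (k + 1) → GaugeField (F.P p.K) k (SU N) → SU N → ℝ≥0),
      (∀ c, MeasurableSet {q : GaugeField (F.P p.K) k (SU N) × SU N | q.2 ∈ T c q.1}) ∧
      (∀ c, Measurable fun q : GaugeField (F.P p.K) k (SU N) × SU N => ϑ c q.1 q.2) ∧
      (∀ c, Measurable fun q : GaugeField (F.P p.K) k (SU N) × SU N => jd c q.1 q.2) ∧
      ∀ᵐ V' ∂(fieldMeasure (F.P p.K) (k + 1) (SU N)), ∀ s : SeqOfRecord F θ.ν θ.τ9.M (gOfRecord₁₃ F N θ.toStage13Params p) p.K (k + 1),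
        slotsTOfRecord F N θ.ν θ.τ9 (EOfRecord₁₃ F N θ.toStage13Params) (wOfRecord₉ F N θ.toStage9Params) θ.ppSel p (gOfRecord₁₃ F N θ.toStage13Params p) (k + 1) s V' =
          kernelRTOfRecord F N p.K k (Set.toFinite (bondsIn k (s.Ω (k + 1))ᶜ)).toFinset (Set.toFinite (bondsIn (k + 1) (s.Ω (k + 1))ᶜ)).toFinset
            (fun y => ∫ uin,
              (({z : ((↥(Set.toFinite (bondsIn k (s.Ω (k + 1))ᶜ)).toFinset → SU N) ×
                    ({c : PBond (F.P p.K) (k + 1) // c ∉ (Set.toFinite (bondsIn (k + 1) (s.Ω (k + 1))ᶜ)).toFinset} → SU N)) ×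
                    ({b : PBond (F.P p.K) k // b ∉ (Set.toFinite (bondsIn k (s.Ω (k + 1))ᶜ)).toFinset} → SU N) |
                  ∀ c : {c : PBond (F.P p.K) (k + 1) // c ∉ (Set.toFinite (bondsIn (k + 1) (s.Ω (k + 1))ᶜ)).toFinset},
                    z.1.2 c ∈ T c ((MeasurableEquiv.piEquivPiSubtypeProd (fun _ : PBond (F.P p.K) k => SU N)
                      (· ∈ (Set.toFinite (bondsIn k (s.Ω (k + 1))ᶜ)).toFinset)).symm (z.1.1, z.2))}.indicator
                (fun z => ∏ c : {c : PBond (F.P p.K) (k + 1) // c ∉ (Set.toFinite (bondsIn (k + 1) (s.Ω (k + 1))ᶜ)).toFinset},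
                  jd c ((MeasurableEquiv.piEquivPiSubtypeProd (fun _ : PBond (F.P p.K) k => SU N)
                    (· ∈ (Set.toFinite (bondsIn k (s.Ω (k + 1))ᶜ)).toFinset)).symm (z.1.1, z.2)) (z.1.2 c))
                ((y, (MeasurableEquiv.piEquivPiSubtypeProd (fun _ : PBond (F.P p.K) (k + 1) => SU N)
                  (· ∈ (Set.toFinite (bondsIn (k + 1) (s.Ω (k + 1))ᶜ)).toFinset) V').2), uin) : ℝ≥0) : ℝ) *
              ((fun U : GaugeField (F.P p.K) k (SU N) =>
                  wOfRecord₉ F N θ.toStage9Params p (gOfRecord₁₃ F N θ.toStage13Params p) k s U V' *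
                    (chiSeqOfRecord F N θ.ν θ.τ9.M (gOfRecord₁₃ F N θ.toStage13Params p) p.K k s.init U *
                      slotsOfRecord F N θ.ν θ.τ9 (EOfRecord₁₃ F N θ.toStage13Params) (wOfRecord₉ F N θ.toStage9Params) θ.ppSel p
                        (gOfRecord₁₃ F N θ.toStage13Params p) k s.init U))
                ((MeasurableEquiv.piEquivPiSubtypeProd (fun _ : PBond (F.P p.K) k => SU N)
                  (· ∈ (Set.toFinite (bondsIn k (s.Ω (k + 1))ᶜ)).toFinset)).symm (y,
                  extend (fun c : {c : PBond (F.P p.K) (k + 1) // c ∉ (Set.toFinite (bondsIn (k + 1) (s.Ω (k + 1))ᶜ)).toFinset} =>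
                      (⟨centralBond (c : PBond (F.P p.K) (k + 1)), centralBond_not_mem_bondsInFinset_compl_Omega hk s c c.2⟩ :
                        {b : PBond (F.P p.K) k // b ∉ (Set.toFinite (bondsIn k (s.Ω (k + 1))ᶜ)).toFinset}))
                    (fun c : {c : PBond (F.P p.K) (k + 1) // c ∉ (Set.toFinite (bondsIn (k + 1) (s.Ω (k + 1))ᶜ)).toFinset} =>
                      ϑ c ((MeasurableEquiv.piEquivPiSubtypeProd (fun _ : PBond (F.P p.K) k => SU N)
                        (· ∈ (Set.toFinite (bondsIn k (s.Ω (k + 1))ᶜ)).toFinset)).symm (y, uin))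
                        ((MeasurableEquiv.piEquivPiSubtypeProd (fun _ : PBond (F.P p.K) (k + 1) => SU N)
                          (· ∈ (Set.toFinite (bondsIn (k + 1) (s.Ω (k + 1))ᶜ)).toFinset) V').2 c)) uin)))
              ∂(Measure.pi fun _ : {b : PBond (F.P p.K) k // b ∉ (Set.toFinite (bondsIn k (s.Ω (k + 1))ᶜ)).toFinset} => (HaarData.haar : Measure (SU N))))
            (MeasurableEquiv.piEquivPiSubtypeProd (fun _ : PBond (F.P p.K) (k + 1) => SU N)
              (· ∈ (Set.toFinite (bondsIn (k + 1) (s.Ω (k + 1))ᶜ)).toFinset) V').1 := by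
  refine exists_ae_forall_slotsTOfRecord₁₃H_succ_eq_kernelRTOfRecord_atRegions_of_provisos_of_plaqSmall p θ h hk hα0 hα hαδ hgap hδ hδα hslot
    fun s U V' hne c hc q hq => ?_
  obtain ⟨t, ht, ha, hb, -⟩ := exists_label_of_wOfRecord_ne_zero θ.ν θ.τ9.M θ.A₁ θ.ζ p (gOfRecord₁₃ F N θ.toStage13Params p) k s U V' hne
  obtain ⟨c', hq', h32, h33⟩ := hcov s t ht c hc q hq
  obtain ⟨h₁, h₂, h₃, h₄⟩ := bonds_mem_bondsStar_of_embIter_mem_cubeχ (N := N) θ.ν θ.τ9.M p (gOfRecord₁₃ F N θ.toStage13Params p) hS s.init c' q hq'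
  exact (dist1_plaqHol_lt_of_smallApproxFluct _ (avOfRecord F N p.K) ((smallApproxFluct_of_bWeight_ne_zero θ.ν θ.τ9.M θ.A₁ p _ k s.init t.1 t.2.1 U V' hb).2 c' h33)
    q h₁ h₂ h₃ h₄ (hbg s V' c' ((plaqSmallOn_ukLoc_of_aWeight_ne_zero θ.ν θ.τ9.M p _ k s.init t.1 V' ha).2 c' h32) q hq')).trans_le hδa

/-! ## §4  def-T's (†) for ALL new sequences at def-R's regions, AT def-T's step weights of record, the support clause reduced to background regularity -/

/-- **★★ def-T's (†) AT def-R's REGIONS OF RECORD, ALL `s′` AT ONCE, AT THE STEP WEIGHTS OF RECORD `w := wOfRecord … A₁ ζ`, THE SUPPORT CLAUSE REDUCED TO BACKGROUND REGULARITY**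
(generic letters `ν M A₁ ζ g`, the edition the per-density (O3′) road consumes): FILE 12 ★ `exists_ae_forall_tstepOfRecord_eq_kernelRTOfRecord_atRegions_of_plaqSmall` at
`w := wOfRecord F N ν M A₁ ζ` with its hypothesis `hwq` REPLACED by `hD : 0 < sideD`, the BACKGROUND row `hbg`, the COVERING row `hcov` and the numerics `a + 4·2δ_k ≤ δ` (as in §3);
displayed as in FILE 12: the α-guards, the rows `hw`∕`hwj`∕`hχ`∕`hT`, GRAPH integrability `hGi`.  `(𝐓e^A)_{k+1}(s′)(V′) = kernelRTOfRecord F N K k sV(s′) sV′(s′) [y ↦ ∫ dU_in 𝟙·∏ jd ·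
(w_k(s′)(·,V′)·χ_k·T)(e(y, extend β′ (ϑ_c(·, r c))_c U_in))] o` for `dV′`-a.e. `V′` and EVERY `s′`.
[cite: Balaban1988Convergent, (2.16)–(2.18) p.257, (2.21) p.258, (3.1) p.264, (3.2)–(3.5) p.265, p.267 L18–24; Balaban1987RG1, (0.4) p.253, (2.9) p.266] -/
theorem exists_ae_forall_tstepOfRecord_eq_kernelRTOfRecord_atRegions_of_background
    (ν : Stage7Numerics) (M : ℕ) (A₁ : ℝ) (ζ : ZetaOfRecord F N ν M) (g : ℕ → ℝ) (hk : k < p.K) (T' : SeqOfRecord F ν M g p.K k → Density (F.P p.K) k (SU N))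
    {α : ℝ} (hα0 : 0 ≤ α) (hα : α ≤ 1 / 24) (hαδ : α < deltaSU (Fin N))
    (hgap : ∀ c : PBond (F.P p.K) (k + 1), (offCard c : ℝ) / (Fintype.card (Idx (F.P p.K)) : ℝ) + 150 * α < 1)
    {δ a : ℝ} (hδ : 0 ≤ δ) (hδa : a + 4 * (2 * deltaOfRecord ν g k A₁) ≤ δ) (hδα : ((((F.P p.K).d + 2) * (F.P p.K).L : ℕ) : ℝ) ^ 2 / 4 * δ ≤ α)
    (hw : ∀ s' V', Measurable fun U => wOfRecord F N ν M A₁ ζ p g k s' U V')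
    (hwj : ∀ s', Measurable fun q : GaugeField (F.P p.K) (k + 1) (SU N) × GaugeField (F.P p.K) k (SU N) => wOfRecord F N ν M A₁ ζ p g k s' q.2 q.1)
    (hχ : ∀ s, Measurable (chiSeqOfRecord F N ν M g p.K k s)) (hT : ∀ s, Measurable (T' s))
    (hS : 0 < sideχ F ν p g k)
    (hbg : ∀ (s' : SeqOfRecord F ν M g p.K (k + 1)) (V' : GaugeField (F.P p.K) (k + 1) (SU N)) (c' : Iχ F ν p g k),
      PlaqSmallOn ((sect3DataOfRecord F N ν M p g k s'.init).plaqT c') (epsOfRecord ν g (k + 1) * (F.P p.K).eta (k + 1) ^ 2) ((sect3DataOfRecord F N ν M p g k s'.init).UkLoc c' V') →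
        ∀ q : Plaq (F.P p.K) k, embIter k q.src ∈ cubeχ F ν p g k c' → dist1 (GaugeField.plaqHol (Vbox (sect3DataOfRecord F N ν M p g k s'.init) (avOfRecord F N p.K) c' V') q) ≤ a)
    (hcov : ∀ (s' : SeqOfRecord F ν M g p.K (k + 1)) (t : LbOfRecord F ν p g k), σOfRecord F ν M p g k s'.init t = s' →
      ∀ c : PBond (F.P p.K) (k + 1), c ∉ bondsIn (k + 1) (s'.Ω (k + 1))ᶜ → ∀ q : Plaq (F.P p.K) k,
        (blockOf q.src = c.src.unshift c.dir ∨ blockOf q.src = c.src ∨ blockOf q.src = c.tgt) →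
          ∃ c' : Iχ F ν p g k, embIter k q.src ∈ cubeχ F ν p g k c' ∧ c' ∈ cubes32 F ν M p g k s'.init \ t.1 ∧ c' ∈ qcubes F ν M p g k s'.init t.1 \ t.2.1)
    (hGi : ∀ s' : SeqOfRecord F ν M g p.K (k + 1),
      Integrable (fun U => wOfRecord F N ν M A₁ ζ p g k s' U ((avOfRecord F N p.K k).avg U) * (chiSeqOfRecord F N ν M g p.K k s'.init U * T' s'.init U))
        (fieldMeasure (F.P p.K) k (SU N))) :
    ∃ (T : PBond (F.P p.K) (k + 1) → GaugeField (F.P p.K) k (SU N) → Set (SU N))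
      (ϑ : PBond (F.P p.K) (k + 1) → GaugeField (F.P p.K) k (SU N) → SU N → SU N)
      (jd : PBond (F.P p.K) (k + 1) → GaugeField (F.P p.K) k (SU N) → SU N → ℝ≥0),
      (∀ c, MeasurableSet {q : GaugeField (F.P p.K) k (SU N) × SU N | q.2 ∈ T c q.1}) ∧
      (∀ c, Measurable fun q : GaugeField (F.P p.K) k (SU N) × SU N => ϑ c q.1 q.2) ∧
      (∀ c, Measurable fun q : GaugeField (F.P p.K) k (SU N) × SU N => jd c q.1 q.2) ∧
      ∀ᵐ V' ∂(fieldMeasure (F.P p.K) (k + 1) (SU N)), ∀ s' : SeqOfRecord F ν M g p.K (k + 1),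
        tstepOfRecord F N ν M (wOfRecord F N ν M A₁ ζ) p g k T' s' V' =
          kernelRTOfRecord F N p.K k (Set.toFinite (bondsIn k (s'.Ω (k + 1))ᶜ)).toFinset (Set.toFinite (bondsIn (k + 1) (s'.Ω (k + 1))ᶜ)).toFinset
            (fun y => ∫ uin,
              (({z : ((↥(Set.toFinite (bondsIn k (s'.Ω (k + 1))ᶜ)).toFinset → SU N) ×
                    ({c : PBond (F.P p.K) (k + 1) // c ∉ (Set.toFinite (bondsIn (k + 1) (s'.Ω (k + 1))ᶜ)).toFinset} → SU N)) ×
                    ({b : PBond (F.P p.K) k // b ∉ (Set.toFinite (bondsIn k (s'.Ω (k + 1))ᶜ)).toFinset} → SU N) |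
                  ∀ c : {c : PBond (F.P p.K) (k + 1) // c ∉ (Set.toFinite (bondsIn (k + 1) (s'.Ω (k + 1))ᶜ)).toFinset},
                    z.1.2 c ∈ T c ((MeasurableEquiv.piEquivPiSubtypeProd (fun _ : PBond (F.P p.K) k => SU N)
                      (· ∈ (Set.toFinite (bondsIn k (s'.Ω (k + 1))ᶜ)).toFinset)).symm (z.1.1, z.2))}.indicator
                (fun z => ∏ c : {c : PBond (F.P p.K) (k + 1) // c ∉ (Set.toFinite (bondsIn (k + 1) (s'.Ω (k + 1))ᶜ)).toFinset},
                  jd c ((MeasurableEquiv.piEquivPiSubtypeProd (fun _ : PBond (F.P p.K) k => SU N)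
                    (· ∈ (Set.toFinite (bondsIn k (s'.Ω (k + 1))ᶜ)).toFinset)).symm (z.1.1, z.2)) (z.1.2 c))
                ((y, (MeasurableEquiv.piEquivPiSubtypeProd (fun _ : PBond (F.P p.K) (k + 1) => SU N)
                  (· ∈ (Set.toFinite (bondsIn (k + 1) (s'.Ω (k + 1))ᶜ)).toFinset) V').2), uin) : ℝ≥0) : ℝ) *
              ((fun U : GaugeField (F.P p.K) k (SU N) => wOfRecord F N ν M A₁ ζ p g k s' U V' * (chiSeqOfRecord F N ν M g p.K k s'.init U * T' s'.init U))
                ((MeasurableEquiv.piEquivPiSubtypeProd (fun _ : PBond (F.P p.K) k => SU N)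
                  (· ∈ (Set.toFinite (bondsIn k (s'.Ω (k + 1))ᶜ)).toFinset)).symm (y,
                  extend (fun c : {c : PBond (F.P p.K) (k + 1) // c ∉ (Set.toFinite (bondsIn (k + 1) (s'.Ω (k + 1))ᶜ)).toFinset} =>
                      (⟨centralBond (c : PBond (F.P p.K) (k + 1)), centralBond_not_mem_bondsInFinset_compl_Omega hk s' c c.2⟩ :
                        {b : PBond (F.P p.K) k // b ∉ (Set.toFinite (bondsIn k (s'.Ω (k + 1))ᶜ)).toFinset}))
                    (fun c : {c : PBond (F.P p.K) (k + 1) // c ∉ (Set.toFinite (bondsIn (k + 1) (s'.Ω (k + 1))ᶜ)).toFinset} =>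
                      ϑ c ((MeasurableEquiv.piEquivPiSubtypeProd (fun _ : PBond (F.P p.K) k => SU N)
                        (· ∈ (Set.toFinite (bondsIn k (s'.Ω (k + 1))ᶜ)).toFinset)).symm (y, uin))
                        ((MeasurableEquiv.piEquivPiSubtypeProd (fun _ : PBond (F.P p.K) (k + 1) => SU N)
                          (· ∈ (Set.toFinite (bondsIn (k + 1) (s'.Ω (k + 1))ᶜ)).toFinset) V').2 c)) uin)))
              ∂(Measure.pi fun _ : {b : PBond (F.P p.K) k // b ∉ (Set.toFinite (bondsIn k (s'.Ω (k + 1))ᶜ)).toFinset} => (HaarData.haar : Measure (SU N))))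
            (MeasurableEquiv.piEquivPiSubtypeProd (fun _ : PBond (F.P p.K) (k + 1) => SU N)
              (· ∈ (Set.toFinite (bondsIn (k + 1) (s'.Ω (k + 1))ᶜ)).toFinset) V').1 := by
  refine exists_ae_forall_tstepOfRecord_eq_kernelRTOfRecord_atRegions_of_plaqSmall p ν M (wOfRecord F N ν M A₁ ζ) g hk T' hα0 hα hαδ hgap hδ hδα hw hwj hχ hT
    (fun s' U V' hne c hc q hq => ?_) hGi
  obtain ⟨t, ht, ha, hb, -⟩ := exists_label_of_wOfRecord_ne_zero ν M A₁ ζ p g k s' U V' hne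
  obtain ⟨c', hq', h32, h33⟩ := hcov s' t ht c hc q hq
  obtain ⟨h₁, h₂, h₃, h₄⟩ := bonds_mem_bondsStar_of_embIter_mem_cubeχ (N := N) ν M p g hS s'.init c' q hq'
  exact (dist1_plaqHol_lt_of_smallApproxFluct _ (avOfRecord F N p.K) ((smallApproxFluct_of_bWeight_ne_zero ν M A₁ p g k s'.init t.1 t.2.1 U V' hb).2 c' h33)
    q h₁ h₂ h₃ h₄ (hbg s' V' c' ((plaqSmallOn_ukLoc_of_aWeight_ne_zero ν M p g k s'.init t.1 V' ha).2 c' h32) q hq')).trans_le hδa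

end Summit.QuantumFields.YangMills.Theorems.BalabanUVNodesN11TStepInnerCentralWindowChartAtRegionsOfSupport

end
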